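import Summits.Parity.GeneralizedHardyLittlewood.Theorems.BeyondDiagonalBeatsQuarter.OffDiagLevelAP
import Mathlib.NumberTheory.PrimeCounting
import HarnessLib

/-!
# Route `PrimeLevelFamEdge`, crux K_B (stmt-Parity-20343), line `diagonal_kernel_split` rev 4, plan Ω, sub-line Ω-e
# (OMEGA-BLUEPRINT v3 §3b «STRATA left for L6′», last item) — **a NON-UNIT class contains no level coprime to the
# modulus, and at most `ω(n) ≤ log₂ n` prime levels in general: the «O(log) levels, trivial» stratum**

After the divisor switch and its strata (`OffDiagBlockSwitch` / `OffDiagBlockStrata`, p648494 / p648654: generic stratum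
`sum_levels_switch_eq_levelAPSum`, reduced modulus `sum_levels_switch_eq_levelAPSum_reduced`) every level sum of the finite
core is an `OffDiag.levelAPSum G F n a` (p640065) in SOME class `a mod n` — a unit class when `(ab/g, n/g) = 1`, for which
`OffDiagLevelCharSplit.levelAPSum_eq_principal_add_smallPart_add_largePart` (p648138) applies, and otherwise a NON-UNIT
class. This file disposes of the non-unit classes:

* **`levelAPSum_eq_zero_of_not_isUnit`** — if every level of `Q` is coprime to `n` (the switched sums carry the filter
  `gcd(h₁, q) = 1`, `OffDiagBlockStrata.sum_levels_switch_eq_sum_filter`), a non-unit class contains NO level: the sum is `0`;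
* without the coprimality filter, over PRIME levels: `filter_natCast_eq_subset_primeFactors` (a non-unit class holds only
  primes dividing `n`), **`card_filter_natCast_eq_le_card_primeFactors`** (`≤ ω(n)`), `card_primeFactors_le_log`
  (`ω(n) ≤ log₂ n`), **`norm_levelAPSum_le_of_not_isUnit`** / `norm_levelAPSum_le_log_of_not_isUnit`
  (`‖levelAPSum G F n a‖ ≤ ω(n)·B ≤ log₂ n·B` for `‖F‖ ≤ B` on `G`).

Elementary; theorems only; standard axioms. Helper toward `stub_offDiagBelowSlack_io`; closes nothing.
«The programme SEARCHES and TYPES; no claim about Landau–Siegel zeros, Theorems 1–2 of arXiv:2211.02515 or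
a repaired Margin232 until a kernel theorem says so.»
-/

noncomputable section

namespace Summit.Parity.GeneralizedHardyLittlewood.Theorems.BeyondDiagonalBeatsQuarter.OffDiag

open Finset

/-! ### Levels coprime to the modulus never fall in a non-unit class -/

section Coprime

variable {n : ℕ}

/-- A level coprime to `n` reduces to a unit mod `n`. [folklore] -/
theorem isUnit_natCast_of_coprime {q : ℕ} (hq : q.Coprime n) : IsUnit ((q : ℕ) : ZMod n) :=
  (ZMod.isUnit_iff_coprime q n).2 hq

/-- **A non-unit class contains no level coprime to the modulus**: if every `q ∈ Q` is coprime to `n` and `a mod n` is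
not a unit, `levelAPSum Q F n a = 0`. [folklore] -/
theorem levelAPSum_eq_zero_of_not_isUnit (Q : Finset ℕ) (F : ℕ → ℂ) {a : ZMod n} (ha : ¬ IsUnit a)
    (hQ : ∀ q ∈ Q, q.Coprime n) : levelAPSum Q F n a = 0 :=
  levelAPSum_eq_zero_of_forall_ne Q F n fun q hq h ↦ ha (h ▸ isUnit_natCast_of_coprime (hQ q hq))

/-- The same with the coprimality written as `gcd = 1` on the integer side (the filter form of `OffDiagBlockStrata`).
[folklore] -/
theorem levelAPSum_filter_gcd_eq_zero_of_not_isUnit (G : Finset ℕ) (F : ℕ → ℂ) (h₁ : ℤ) {a : ZMod h₁.natAbs}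
    (ha : ¬ IsUnit a) :
    levelAPSum (G.filter (fun q : ℕ ↦ Int.gcd h₁ q = 1)) F h₁.natAbs a = 0 := by
  refine levelAPSum_eq_zero_of_not_isUnit _ F ha fun q hq ↦ ?_
  have hg : Int.gcd h₁ q = 1 := (Finset.mem_filter.1 hq).2
  rw [Int.gcd_comm] at hg
  -- `Int.gcd q h₁ = Nat.gcd q |h₁|`
  simpa [Int.gcd, Int.natAbs_natCast] using hg

end Coprime

/-! ### A non-unit class contains at most `ω(n)` prime levels -/

section NonUnit

variable {n : ℕ}

/-- Over prime levels, a residue class `a mod n` (`n ≠ 0`) that is NOT a unit contains only primes dividing `n`.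
[folklore] -/
theorem filter_natCast_eq_subset_primeFactors (hn : n ≠ 0) {a : ZMod n} (ha : ¬ IsUnit a) (G : Finset ℕ)
    (hG : ∀ q ∈ G, q.Prime) : G.filter (fun q : ℕ ↦ (q : ZMod n) = a) ⊆ n.primeFactors := by
  intro q hq
  obtain ⟨hqG, hqa⟩ := Finset.mem_filter.1 hq
  have hqp := hG q hqG
  refine Nat.mem_primeFactors.2 ⟨hqp, ?_, hn⟩
  by_contra hdvd
  exact ha (hqa ▸ (ZMod.isUnit_iff_coprime q n).2 ((Nat.Prime.coprime_iff_not_dvd hqp).2 hdvd))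

/-- **A non-unit class contains at most `ω(n)` prime levels** (`n ≠ 0`). [folklore] -/
theorem card_filter_natCast_eq_le_card_primeFactors (hn : n ≠ 0) {a : ZMod n} (ha : ¬ IsUnit a) (G : Finset ℕ)
    (hG : ∀ q ∈ G, q.Prime) : (G.filter (fun q : ℕ ↦ (q : ZMod n) = a)).card ≤ n.primeFactors.card :=
  Finset.card_le_card (filter_natCast_eq_subset_primeFactors hn ha G hG)

/-- `ω(n) ≤ log₂ n`: `2^{ω(n)} ≤ ∏_{p ∣ n} p ≤ n` for `n ≠ 0`. [folklore] -/
theorem card_primeFactors_le_log (hn : n ≠ 0) : n.primeFactors.card ≤ Nat.log 2 n := by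
  refine Nat.le_log_of_pow_le one_lt_two ?_
  calc 2 ^ n.primeFactors.card ≤ ∏ p ∈ n.primeFactors, p :=
        Finset.pow_card_le_prod _ _ _ fun p hp ↦ (Nat.prime_of_mem_primeFactors hp).two_le
    _ ≤ n := Nat.le_of_dvd (Nat.pos_of_ne_zero hn) (Nat.prod_primeFactors_dvd n)

/-- **The level sum over a non-unit class is trivially small**: for prime levels `G` with `‖F q‖ ≤ B` (`B ≥ 0`) and a
class `a mod n` (`n ≠ 0`) that is not a unit, `‖levelAPSum G F n a‖ ≤ ω(n)·B ≤ log₂ n · B` — the «O(log) levels,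
trivial» stratum of OMEGA-BLUEPRINT §3b. [folklore] -/
theorem norm_levelAPSum_le_of_not_isUnit (hn : n ≠ 0) {a : ZMod n} (ha : ¬ IsUnit a) (G : Finset ℕ)
    (hG : ∀ q ∈ G, q.Prime) (F : ℕ → ℂ) {B : ℝ} (hB0 : 0 ≤ B) (hB : ∀ q ∈ G, ‖F q‖ ≤ B) :
    ‖levelAPSum G F n a‖ ≤ (n.primeFactors.card : ℝ) * B := by
  rw [levelAPSum]
  calc ‖∑ q ∈ G.filter (fun q : ℕ ↦ (q : ZMod n) = a), F q‖
      ≤ ∑ q ∈ G.filter (fun q : ℕ ↦ (q : ZMod n) = a), ‖F q‖ := norm_sum_le _ _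
    _ ≤ ∑ _q ∈ G.filter (fun q : ℕ ↦ (q : ZMod n) = a), B :=
        Finset.sum_le_sum fun q hq ↦ hB q (Finset.mem_filter.1 hq).1
    _ = ((G.filter (fun q : ℕ ↦ (q : ZMod n) = a)).card : ℝ) * B := by rw [Finset.sum_const, nsmul_eq_mul]
    _ ≤ (n.primeFactors.card : ℝ) * B := by
        exact mul_le_mul_of_nonneg_right
          (by exact_mod_cast card_filter_natCast_eq_le_card_primeFactors hn ha G hG) hB0

/-- The same bound with `log₂ n` in place of `ω(n)`. [folklore] -/
theorem norm_levelAPSum_le_log_of_not_isUnit (hn : n ≠ 0) {a : ZMod n} (ha : ¬ IsUnit a) (G : Finset ℕ)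
    (hG : ∀ q ∈ G, q.Prime) (F : ℕ → ℂ) {B : ℝ} (hB0 : 0 ≤ B) (hB : ∀ q ∈ G, ‖F q‖ ≤ B) :
    ‖levelAPSum G F n a‖ ≤ (Nat.log 2 n : ℝ) * B :=
  (norm_levelAPSum_le_of_not_isUnit hn ha G hG F hB0 hB).trans
    (mul_le_mul_of_nonneg_right (by exact_mod_cast card_primeFactors_le_log hn) hB0)

end NonUnit

end Summit.Parity.GeneralizedHardyLittlewood.Theorems.BeyondDiagonalBeatsQuarter.OffDiag
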